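import Literature.MathematicalPhysics.QuantumLattice.HubbardChemicalPotentialTL
import HarnessLib

/-!
# The chemical-potential CELL of a filling box and the slope sandwich (Lipschitz word in the filling)
# of the 2D `t–t'` Hubbard energy density

Topic `MathematicalPhysics/QuantumLattice` (family `hubbard`); namespace
`Literature.MathematicalPhysics.QuantumLattice.ThermodynamicLimit`. Companion of
`HubbardFillingBoxEnergyBounds.lean` (box caps / floors) and of `HubbardChemicalPotentialTL.lean`
(`μ₊ = chemPotPlusTT'`, `μ₋ = chemPotMinusTT'`, the one-sided density derivatives of the convex energy
density `e(n) = energyDensityTT' t t' U n`, `U ≥ 0`; Lieb–Wu 2003 §7, Ruelle 1969 §3.4). Written for the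
material-oracle pipeline: the downfold hands the certifier a FILLING BOX `n ∈ [n₁, n₂]`, whereas a
grand-canonical certifier works at a chemical potential `μ`. This file is the dictionary between the two
and the Lipschitz constant of `e` in the filling over a box, all from four certified POINT rows:

* §1 THE CELL: a cap `e(n₀) ≤ hi₀`, floors `lo₁ ≤ e(n₁)`, `lo₂ ≤ e(n₂)` and a cap `e(n₃) ≤ hi₃`
  (`0 ≤ n₀ < n₁`, `n₂ < n₃ < 2`) give, UNIFORMLY for `n ∈ [n₁, n₂]`,
  `μlo := (lo₁ - hi₀)/(n₁ - n₀) ≤ μ₋(n) ≤ μ₊(n) ≤ μhi := (hi₃ - lo₂)/(n₃ - n₂)`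
  (`chemPotMinusTT'_ge_of_bounds_of_le`, `chemPotPlusTT'_le_of_bounds_of_le`,
  `chemPot_mem_cell_of_mem_Icc`: `μ±` are monotone, so the point rows of `HubbardChemicalPotentialTL`
  transport across the box).
* §2 THE ENSEMBLE DICTIONARY (`T = 0` equivalence of ensembles at the level of the energy density;
  Ruelle §3.4, Lieb–Wu §7 — the chemical potentials at which a state of density `n` is a grand-canonical
  ground state): `μ ∈ [μ₋(n), μ₊(n)] ↔ n minimises x ↦ e(x) - μ x on [0, 2)`
  (`mem_Icc_chemPot_iff_isMinOn`; the converse half uses Mathlib's `μ₊ = inf` of forward / `μ₋ = sup` of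
  backward secant slopes). Hence EVERY density of the box is a grand-canonical minimising density for some
  `μ` of the cell `[μlo, μhi]` (`exists_chemPot_mem_cell_isMinOn_of_mem_Icc`: the filling box is COVERED
  by a chemical-potential cell the grand-canonical certifier can scan), and conversely a grand-canonical
  minimising density at `μ` is LOCALISED by two rows (`lt_density_of_isMinOn_of_bounds`: a secant ceiling
  on `μ₊(m)` below `μ` forces `m < n`; `density_lt_of_isMinOn_of_bounds`).
* §3 SLOPE SANDWICH on a box: for `m ≤ n` in `[n₁, n₂] ⊂ (0, 2)`,
  `μ₊(n₁)(n - m) ≤ e(n) - e(m) ≤ μ₋(n₂)(n - m)` (`energyDensityTT'_sub_mem_Icc_of_mem_Icc`), hence with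
  the four rows `μlo (n - m) ≤ e(n) - e(m) ≤ μhi (n - m)` (`energyDensityTT'_sub_mem_Icc_of_bounds`) and
  `|e(n) - e(m)| ≤ max |μlo| |μhi| · |n - m|` (`abs_energyDensityTT'_sub_le_of_bounds`) — the certified
  Lipschitz constant of the energy word in the filling.

HONEST LIMITS. No value of `μ±` is computed; the cell is only as tight as the four rows; densities
`n ∉ (0, 2)` carry Mathlib's junk one-sided derivatives and are excluded by hypothesis. Everything is
PROVED; no definition, no named fact, no sorry.

## Tree search (cited, not restated)

`chemPotMinusTT'_ge_of_bounds`, `chemPotPlusTT'_le_of_bounds`, `chemPotMinusTT'_mono`,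
`chemPotPlusTT'_mono`, `chemPotMinusTT'_le_chemPotPlusTT'`, `slope_le_chemPotMinusTT'`,
`chemPotPlusTT'_le_slope`, `energyDensityTT'_add_mul_le_of_mem_Icc`, `mem_interior_Ico_zero_two`,
`convexOn_energyDensityTT'`; Mathlib `ConvexOn.rightDeriv_eq_sInf_slope_of_mem_interior`,
`ConvexOn.leftDeriv_eq_sSup_slope_of_mem_interior`.

## References

* D. Ruelle, *Statistical Mechanics: Rigorous Results* (1969), §3.4 (density versus chemical
  potential; equivalence of ensembles). [cite: Ruelle1969, §3.4]
* E. H. Lieb, F. Y. Wu, Physica A 321 (2003) 1–27, §7 (`μ₊`/`μ₋` = right/left derivative of the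
  convex `e`, `μ₋ ≤ μ₊`, monotone). [cite: LiebWuPhysicaA2003, §7]
-/

noncomputable section

namespace Literature.MathematicalPhysics.QuantumLattice

namespace ThermodynamicLimit

open Set

/-! ### §1 The chemical-potential cell of a filling box -/

/-- **`μ₋` FLOOR transported UP the box**: a cap `e(n₀) ≤ hi₀` and a floor `lo₁ ≤ e(n₁)` with
`0 ≤ n₀ < n₁` give `(lo₁ - hi₀)/(n₁ - n₀) ≤ μ₋(n)` for EVERY `n ∈ [n₁, 2)` (`μ₋` is non-decreasing;
`U ≥ 0`). [cite: LiebWuPhysicaA2003, §7] -/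
theorem chemPotMinusTT'_ge_of_bounds_of_le (t t' : ℝ) {U : ℝ} (hU : 0 ≤ U) {n₀ n₁ lo₁ hi₀ : ℝ}
    (hn₀ : 0 ≤ n₀) (h₀₁ : n₀ < n₁) (hhi₀ : energyDensityTT' t t' U n₀ ≤ hi₀)
    (hlo₁ : lo₁ ≤ energyDensityTT' t t' U n₁) {n : ℝ} (h₁ : n₁ ≤ n) (hn2 : n < 2) :
    (lo₁ - hi₀) / (n₁ - n₀) ≤ chemPotMinusTT' t t' U n :=
  (chemPotMinusTT'_ge_of_bounds t t' hU hn₀ h₀₁ (lt_of_le_of_lt h₁ hn2) hlo₁ hhi₀).trans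
    (chemPotMinusTT'_mono t t' hU (hn₀.trans_lt h₀₁) h₁ hn2)

/-- **`μ₊` CEILING transported DOWN the box**: a floor `lo₂ ≤ e(n₂)` and a cap `e(n₃) ≤ hi₃` with
`n₂ < n₃ < 2` give `μ₊(n) ≤ (hi₃ - lo₂)/(n₃ - n₂)` for EVERY `n ∈ (0, n₂]` (`U ≥ 0`).
[cite: LiebWuPhysicaA2003, §7] -/
theorem chemPotPlusTT'_le_of_bounds_of_le (t t' : ℝ) {U : ℝ} (hU : 0 ≤ U) {n₂ n₃ lo₂ hi₃ : ℝ}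
    (h₂₃ : n₂ < n₃) (hn₃ : n₃ < 2) (hlo₂ : lo₂ ≤ energyDensityTT' t t' U n₂)
    (hhi₃ : energyDensityTT' t t' U n₃ ≤ hi₃) {n : ℝ} (hn0 : 0 < n) (h₂ : n ≤ n₂) :
    chemPotPlusTT' t t' U n ≤ (hi₃ - lo₂) / (n₃ - n₂) :=
  (chemPotPlusTT'_mono t t' hU hn0 h₂ (h₂₃.trans hn₃)).trans
    (chemPotPlusTT'_le_of_bounds t t' hU (hn0.trans_le h₂) h₂₃ hn₃ hlo₂ hhi₃)

/-- **The chemical-potential CELL of a filling box.** Four certified rows — a cap `e(n₀) ≤ hi₀`, floors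
`lo₁ ≤ e(n₁)`, `lo₂ ≤ e(n₂)` and a cap `e(n₃) ≤ hi₃`, `0 ≤ n₀ < n₁ ≤ n₂ < n₃ < 2`, `U ≥ 0` — give,
UNIFORMLY for `n ∈ [n₁, n₂]`,
`(lo₁ - hi₀)/(n₁ - n₀) ≤ μ₋(n) ≤ μ₊(n) ≤ (hi₃ - lo₂)/(n₃ - n₂)`: the subdifferential of `e` at every
density of the box lies in one explicit cell `[μlo, μhi]`. [cite: LiebWuPhysicaA2003, §7] -/
theorem chemPot_mem_cell_of_mem_Icc (t t' : ℝ) {U : ℝ} (hU : 0 ≤ U)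
    {n₀ n₁ n₂ n₃ hi₀ lo₁ lo₂ hi₃ : ℝ} (hn₀ : 0 ≤ n₀) (h₀₁ : n₀ < n₁) (h₂₃ : n₂ < n₃)
    (hn₃ : n₃ < 2) (hhi₀ : energyDensityTT' t t' U n₀ ≤ hi₀) (hlo₁ : lo₁ ≤ energyDensityTT' t t' U n₁)
    (hlo₂ : lo₂ ≤ energyDensityTT' t t' U n₂) (hhi₃ : energyDensityTT' t t' U n₃ ≤ hi₃)
    {n : ℝ} (hn : n ∈ Icc n₁ n₂) :
    (lo₁ - hi₀) / (n₁ - n₀) ≤ chemPotMinusTT' t t' U n ∧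
      chemPotMinusTT' t t' U n ≤ chemPotPlusTT' t t' U n ∧
      chemPotPlusTT' t t' U n ≤ (hi₃ - lo₂) / (n₃ - n₂) := by
  have hn0 : 0 < n := (hn₀.trans_lt h₀₁).trans_le hn.1
  have hn2 : n < 2 := lt_of_le_of_lt hn.2 (h₂₃.trans hn₃)
  exact ⟨chemPotMinusTT'_ge_of_bounds_of_le t t' hU hn₀ h₀₁ hhi₀ hlo₁ hn.1 hn2,
    chemPotMinusTT'_le_chemPotPlusTT' t t' hU hn0 hn2,
    chemPotPlusTT'_le_of_bounds_of_le t t' hU h₂₃ hn₃ hlo₂ hhi₃ hn0 hn.2⟩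

/-! ### §2 The ensemble dictionary: filling box ↔ chemical-potential cell -/

/-- **Ensemble dictionary, easy direction**: if `μ₋(n) ≤ μ ≤ μ₊(n)` (`0 < n < 2`, `U ≥ 0`) then `n`
minimises `x ↦ e(x) - μ x` on `[0, 2)` — a canonical state of density `n` is a grand-canonical ground
state at every chemical potential of its subdifferential (`energyDensityTT'_add_mul_le_of_mem_Icc`
rewritten). [cite: Ruelle1969, §3.4] -/
theorem isMinOn_sub_mul_of_mem_Icc_chemPot (t t' : ℝ) {U : ℝ} (hU : 0 ≤ U) {n μ : ℝ} (hn0 : 0 < n)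
    (hn2 : n < 2) (hμ : μ ∈ Icc (chemPotMinusTT' t t' U n) (chemPotPlusTT' t t' U n)) :
    IsMinOn (fun x => energyDensityTT' t t' U x - μ * x) (Ico (0 : ℝ) 2) n := by
  intro x hx
  have h := energyDensityTT'_add_mul_le_of_mem_Icc t t' hU hn0 hn2 hμ.1 hμ.2 hx.1 hx.2
  show energyDensityTT' t t' U n - μ * n ≤ energyDensityTT' t t' U x - μ * x
  nlinarith [h]

/-- **Ensemble dictionary, converse, right half**: if `n ∈ (0, 2)` minimises `x ↦ e(x) - μ x` on
`[0, 2)` then `μ ≤ μ₊(n)` (`μ₊(n)` is the infimum of the forward secant slopes, each of which is `≥ μ`).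
[cite: Ruelle1969, §3.4] [cite: LiebWuPhysicaA2003, §7] -/
theorem le_chemPotPlusTT'_of_isMinOn (t t' : ℝ) {U : ℝ} (hU : 0 ≤ U) {n μ : ℝ} (hn0 : 0 < n)
    (hn2 : n < 2) (hmin : IsMinOn (fun x => energyDensityTT' t t' U x - μ * x) (Ico (0 : ℝ) 2) n) :
    μ ≤ chemPotPlusTT' t t' U n := by
  rw [chemPotPlusTT', (convexOn_energyDensityTT' t t' hU).rightDeriv_eq_sInf_slope_of_mem_interior
    (mem_interior_Ico_zero_two hn0 hn2)]
  have hne : (slope (energyDensityTT' t t' U) n '' {y | y ∈ Ico (0 : ℝ) 2 ∧ n < y}).Nonempty :=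
    ⟨_, ⟨(n + 2) / 2, ⟨⟨by linarith, by linarith⟩, by linarith⟩, rfl⟩⟩
  refine le_csInf hne ?_
  rintro _ ⟨y, ⟨hy, hny⟩, rfl⟩
  have h := hmin hy
  simp only [mem_setOf_eq] at h
  rw [slope_def_field, le_div_iff₀ (sub_pos.2 hny)]
  nlinarith [h]

/-- **Ensemble dictionary, converse, left half**: if `n ∈ (0, 2)` minimises `x ↦ e(x) - μ x` on
`[0, 2)` then `μ₋(n) ≤ μ`. [cite: Ruelle1969, §3.4] [cite: LiebWuPhysicaA2003, §7] -/
theorem chemPotMinusTT'_le_of_isMinOn (t t' : ℝ) {U : ℝ} (hU : 0 ≤ U) {n μ : ℝ} (hn0 : 0 < n)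
    (hn2 : n < 2) (hmin : IsMinOn (fun x => energyDensityTT' t t' U x - μ * x) (Ico (0 : ℝ) 2) n) :
    chemPotMinusTT' t t' U n ≤ μ := by
  rw [chemPotMinusTT', (convexOn_energyDensityTT' t t' hU).leftDeriv_eq_sSup_slope_of_mem_interior
    (mem_interior_Ico_zero_two hn0 hn2)]
  have hne : (slope (energyDensityTT' t t' U) n '' {y | y ∈ Ico (0 : ℝ) 2 ∧ y < n}).Nonempty :=
    ⟨_, ⟨n / 2, ⟨⟨by linarith, by linarith⟩, by linarith⟩, rfl⟩⟩
  refine csSup_le hne ?_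
  rintro _ ⟨y, ⟨hy, hyn⟩, rfl⟩
  have h := hmin hy
  simp only [mem_setOf_eq] at h
  rw [slope_def_field, show (energyDensityTT' t t' U y - energyDensityTT' t t' U n) / (y - n) =
    (energyDensityTT' t t' U n - energyDensityTT' t t' U y) / (n - y) by
      rw [← neg_sub, ← neg_sub n y, neg_div_neg_eq], div_le_iff₀ (sub_pos.2 hyn)]
  nlinarith [h]

/-- **Ensemble dictionary** (`T = 0` equivalence of ensembles at the level of the energy density):
for `0 < n < 2`, `U ≥ 0`, `μ ∈ [μ₋(n), μ₊(n)]` iff the density `n` minimises `x ↦ e(x) - μ x` on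
`[0, 2)`, i.e. iff `n` is a grand-canonical ground-state density at chemical potential `μ`.
[cite: Ruelle1969, §3.4] [cite: LiebWuPhysicaA2003, §7] -/
theorem mem_Icc_chemPot_iff_isMinOn (t t' : ℝ) {U : ℝ} (hU : 0 ≤ U) {n μ : ℝ} (hn0 : 0 < n)
    (hn2 : n < 2) :
    μ ∈ Icc (chemPotMinusTT' t t' U n) (chemPotPlusTT' t t' U n) ↔
      IsMinOn (fun x => energyDensityTT' t t' U x - μ * x) (Ico (0 : ℝ) 2) n :=
  ⟨isMinOn_sub_mul_of_mem_Icc_chemPot t t' hU hn0 hn2, fun h =>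
    ⟨chemPotMinusTT'_le_of_isMinOn t t' hU hn0 hn2 h, le_chemPotPlusTT'_of_isMinOn t t' hU hn0 hn2 h⟩⟩

/-- **A FILLING BOX IS COVERED BY A CHEMICAL-POTENTIAL CELL.** With the four rows of
`chemPot_mem_cell_of_mem_Icc`: every density `n ∈ [n₁, n₂]` is a grand-canonical minimising density for
some chemical potential `μ` of the explicit cell `[(lo₁ - hi₀)/(n₁ - n₀), (hi₃ - lo₂)/(n₃ - n₂)]` — a
grand-canonical certifier scanning that cell meets every filling of the box. [cite: Ruelle1969, §3.4]
[cite: LiebWuPhysicaA2003, §7] -/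
theorem exists_chemPot_mem_cell_isMinOn_of_mem_Icc (t t' : ℝ) {U : ℝ} (hU : 0 ≤ U)
    {n₀ n₁ n₂ n₃ hi₀ lo₁ lo₂ hi₃ : ℝ} (hn₀ : 0 ≤ n₀) (h₀₁ : n₀ < n₁) (h₂₃ : n₂ < n₃)
    (hn₃ : n₃ < 2) (hhi₀ : energyDensityTT' t t' U n₀ ≤ hi₀) (hlo₁ : lo₁ ≤ energyDensityTT' t t' U n₁)
    (hlo₂ : lo₂ ≤ energyDensityTT' t t' U n₂) (hhi₃ : energyDensityTT' t t' U n₃ ≤ hi₃)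
    {n : ℝ} (hn : n ∈ Icc n₁ n₂) :
    ∃ μ ∈ Icc ((lo₁ - hi₀) / (n₁ - n₀)) ((hi₃ - lo₂) / (n₃ - n₂)),
      IsMinOn (fun x => energyDensityTT' t t' U x - μ * x) (Ico (0 : ℝ) 2) n := by
  obtain ⟨h1, h2, h3⟩ := chemPot_mem_cell_of_mem_Icc t t' hU hn₀ h₀₁ h₂₃ hn₃ hhi₀ hlo₁ hlo₂ hhi₃ hn
  have hn0 : 0 < n := (hn₀.trans_lt h₀₁).trans_le hn.1
  have hn2 : n < 2 := lt_of_le_of_lt hn.2 (h₂₃.trans hn₃)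
  exact ⟨chemPotMinusTT' t t' U n, ⟨h1, h2.trans h3⟩,
    isMinOn_sub_mul_of_mem_Icc_chemPot t t' hU hn0 hn2 ⟨le_rfl, h2⟩⟩

/-- **Localising a grand-canonical density from BELOW**: if `n ∈ (0, 2)` is a minimising density at
`μ` and at some density `m ∈ (0, 2)` the chemical potential is exceeded, `μ₊(m) < μ`, then `m < n`
(`μ₊` is non-decreasing and `μ ≤ μ₊(n)`). [cite: LiebWuPhysicaA2003, §7] -/
theorem lt_density_of_isMinOn_of_chemPotPlus_lt (t t' : ℝ) {U : ℝ} (hU : 0 ≤ U) {n m μ : ℝ}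
    (hn0 : 0 < n) (hn2 : n < 2) (hm2 : m < 2)
    (hmin : IsMinOn (fun x => energyDensityTT' t t' U x - μ * x) (Ico (0 : ℝ) 2) n)
    (hlt : chemPotPlusTT' t t' U m < μ) : m < n := by
  by_contra h
  have hnm : n ≤ m := not_lt.1 h
  -- `μ ≤ μ₊(n) ≤ μ₊(m) < μ`
  have h1 := le_chemPotPlusTT'_of_isMinOn t t' hU hn0 hn2 hmin
  have h2 := chemPotPlusTT'_mono t t' hU hn0 hnm hm2
  exact absurd (h1.trans h2) (not_le.2 hlt)

/-- **Localising a grand-canonical density from ABOVE**: if `n ∈ (0, 2)` is a minimising density at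
`μ` and `μ < μ₋(m)` at some `m ∈ (0, 2)`, then `n < m`. [cite: LiebWuPhysicaA2003, §7] -/
theorem density_lt_of_isMinOn_of_lt_chemPotMinus (t t' : ℝ) {U : ℝ} (hU : 0 ≤ U) {n m μ : ℝ}
    (hn0 : 0 < n) (hn2 : n < 2) (hm0 : 0 < m)
    (hmin : IsMinOn (fun x => energyDensityTT' t t' U x - μ * x) (Ico (0 : ℝ) 2) n)
    (hlt : μ < chemPotMinusTT' t t' U m) : n < m := by
  by_contra h
  have hmn : m ≤ n := not_lt.1 h
  -- `μ₋(m) ≤ μ₋(n) ≤ μ < μ₋(m)`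
  have h1 := chemPotMinusTT'_le_of_isMinOn t t' hU hn0 hn2 hmin
  have h2 := chemPotMinusTT'_mono t t' hU hm0 hmn hn2
  exact absurd (lt_of_lt_of_le hlt (h2.trans h1)) (lt_irrefl μ)

/-- **Row form of the localisation from below**: a floor `lo ≤ e(m)` and a cap `e(p) ≤ hi` at
`0 < m < p < 2` with `(hi - lo)/(p - m) < μ` force every minimising density `n ∈ (0, 2)` at `μ` to
satisfy `m < n` (`μ₊(m) ≤ (hi - lo)/(p - m)`, `chemPotPlusTT'_le_of_bounds`). [cite: LiebWuPhysicaA2003, §7] -/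
theorem lt_density_of_isMinOn_of_bounds (t t' : ℝ) {U : ℝ} (hU : 0 ≤ U) {n m p lo hi μ : ℝ}
    (hn0 : 0 < n) (hn2 : n < 2) (hm0 : 0 < m) (hmp : m < p) (hp2 : p < 2)
    (hlo : lo ≤ energyDensityTT' t t' U m) (hhi : energyDensityTT' t t' U p ≤ hi)
    (hmin : IsMinOn (fun x => energyDensityTT' t t' U x - μ * x) (Ico (0 : ℝ) 2) n)
    (hμ : (hi - lo) / (p - m) < μ) : m < n :=
  lt_density_of_isMinOn_of_chemPotPlus_lt t t' hU hn0 hn2 (hmp.trans hp2) hmin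
    ((chemPotPlusTT'_le_of_bounds t t' hU hm0 hmp hp2 hlo hhi).trans_lt hμ)

/-- **Row form of the localisation from above**: a cap `e(q) ≤ hi` and a floor `lo ≤ e(m)` at
`0 ≤ q < m < 2` with `μ < (lo - hi)/(m - q)` force every minimising density `n ∈ (0, 2)` at `μ` to
satisfy `n < m` (`(lo - hi)/(m - q) ≤ μ₋(m)`, `chemPotMinusTT'_ge_of_bounds`). [cite: LiebWuPhysicaA2003, §7] -/
theorem density_lt_of_isMinOn_of_bounds (t t' : ℝ) {U : ℝ} (hU : 0 ≤ U) {n q m lo hi μ : ℝ}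
    (hn0 : 0 < n) (hn2 : n < 2) (hq0 : 0 ≤ q) (hqm : q < m) (hm2 : m < 2)
    (hhi : energyDensityTT' t t' U q ≤ hi) (hlo : lo ≤ energyDensityTT' t t' U m)
    (hmin : IsMinOn (fun x => energyDensityTT' t t' U x - μ * x) (Ico (0 : ℝ) 2) n)
    (hμ : μ < (lo - hi) / (m - q)) : n < m :=
  density_lt_of_isMinOn_of_lt_chemPotMinus t t' hU hn0 hn2 (hq0.trans_lt hqm) hmin
    (hμ.trans_le (chemPotMinusTT'_ge_of_bounds t t' hU hq0 hqm hm2 hlo hhi))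

/-! ### §3 Slope sandwich on a filling box (the Lipschitz word in the filling) -/

/-- **Slope sandwich by the chemical potentials at the box ends**: for `m ≤ n` in a box
`[n₁, n₂] ⊂ (0, 2)` (`U ≥ 0`), `μ₊(n₁)(n - m) ≤ e(n) - e(m) ≤ μ₋(n₂)(n - m)`.
[cite: LiebWuPhysicaA2003, §7] -/
theorem energyDensityTT'_sub_mem_Icc_of_mem_Icc (t t' : ℝ) {U : ℝ} (hU : 0 ≤ U) {n₁ n₂ m n : ℝ}
    (hn₁ : 0 < n₁) (hn₂ : n₂ < 2) (hm : m ∈ Icc n₁ n₂) (hn : n ∈ Icc n₁ n₂) (hmn : m ≤ n) :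
    chemPotPlusTT' t t' U n₁ * (n - m) ≤ energyDensityTT' t t' U n - energyDensityTT' t t' U m ∧
      energyDensityTT' t t' U n - energyDensityTT' t t' U m ≤ chemPotMinusTT' t t' U n₂ * (n - m) := by
  rcases eq_or_lt_of_le hmn with h | h
  · subst h
    simp
  have hm0 : 0 < m := hn₁.trans_le hm.1
  have hn2 : n < 2 := lt_of_le_of_lt hn.2 hn₂
  have hd : 0 < n - m := sub_pos.2 h
  -- forward: `μ₊(n₁) ≤ μ₊(m) ≤ slope(m, n)`
  have h1 := (chemPotPlusTT'_mono t t' hU hn₁ hm.1 (lt_of_le_of_lt hm.2 hn₂)).trans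
    (chemPotPlusTT'_le_slope t t' hU hm0 h hn2)
  -- backward: `slope(m, n) ≤ μ₋(n) ≤ μ₋(n₂)`
  have h2 := (slope_le_chemPotMinusTT' t t' hU hm0.le h hn2).trans
    (chemPotMinusTT'_mono t t' hU (hm0.trans h) hn.2 hn₂)
  rw [le_div_iff₀ hd] at h1
  rw [div_le_iff₀ hd] at h2
  exact ⟨h1, h2⟩

/-- **Slope sandwich by certified ROWS** (the four rows of `chemPot_mem_cell_of_mem_Icc`): for
`m ≤ n` in `[n₁, n₂]`, `μlo (n - m) ≤ e(n) - e(m) ≤ μhi (n - m)` with `μlo = (lo₁ - hi₀)/(n₁ - n₀)`,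
`μhi = (hi₃ - lo₂)/(n₃ - n₂)`. [cite: LiebWuPhysicaA2003, §7] -/
theorem energyDensityTT'_sub_mem_Icc_of_bounds (t t' : ℝ) {U : ℝ} (hU : 0 ≤ U)
    {n₀ n₁ n₂ n₃ hi₀ lo₁ lo₂ hi₃ : ℝ} (hn₀ : 0 ≤ n₀) (h₀₁ : n₀ < n₁) (h₁₂ : n₁ ≤ n₂) (h₂₃ : n₂ < n₃)
    (hn₃ : n₃ < 2) (hhi₀ : energyDensityTT' t t' U n₀ ≤ hi₀) (hlo₁ : lo₁ ≤ energyDensityTT' t t' U n₁)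
    (hlo₂ : lo₂ ≤ energyDensityTT' t t' U n₂) (hhi₃ : energyDensityTT' t t' U n₃ ≤ hi₃)
    {m n : ℝ} (hm : m ∈ Icc n₁ n₂) (hn : n ∈ Icc n₁ n₂) (hmn : m ≤ n) :
    (lo₁ - hi₀) / (n₁ - n₀) * (n - m) ≤ energyDensityTT' t t' U n - energyDensityTT' t t' U m ∧
      energyDensityTT' t t' U n - energyDensityTT' t t' U m ≤ (hi₃ - lo₂) / (n₃ - n₂) * (n - m) := by
  have hn₁ : 0 < n₁ := hn₀.trans_lt h₀₁
  have hn₂ : n₂ < 2 := h₂₃.trans hn₃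
  obtain ⟨h1, h2⟩ := energyDensityTT'_sub_mem_Icc_of_mem_Icc t t' hU hn₁ hn₂ hm hn hmn
  obtain ⟨c1, c2, c3⟩ := chemPot_mem_cell_of_mem_Icc t t' hU hn₀ h₀₁ h₂₃ hn₃ hhi₀ hlo₁ hlo₂ hhi₃
    (n := n₁) ⟨le_rfl, h₁₂⟩
  obtain ⟨d1, d2, d3⟩ := chemPot_mem_cell_of_mem_Icc t t' hU hn₀ h₀₁ h₂₃ hn₃ hhi₀ hlo₁ hlo₂ hhi₃
    (n := n₂) ⟨h₁₂, le_rfl⟩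
  have hd : 0 ≤ n - m := sub_nonneg.2 hmn
  -- `μlo ≤ μ₋(n₁) ≤ μ₊(n₁)` and `μ₋(n₂) ≤ μ₊(n₂) ≤ μhi`
  refine ⟨le_trans (mul_le_mul_of_nonneg_right (c1.trans c2) hd) h1,
    h2.trans (mul_le_mul_of_nonneg_right (d2.trans d3) hd)⟩

/-- **Lipschitz word in the filling**: with the same four rows, for all `m, n ∈ [n₁, n₂]`,
`|e(n) - e(m)| ≤ max |μlo| |μhi| · |n - m|`. [cite: LiebWuPhysicaA2003, §7] -/
theorem abs_energyDensityTT'_sub_le_of_bounds (t t' : ℝ) {U : ℝ} (hU : 0 ≤ U)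
    {n₀ n₁ n₂ n₃ hi₀ lo₁ lo₂ hi₃ : ℝ} (hn₀ : 0 ≤ n₀) (h₀₁ : n₀ < n₁) (h₁₂ : n₁ ≤ n₂) (h₂₃ : n₂ < n₃)
    (hn₃ : n₃ < 2) (hhi₀ : energyDensityTT' t t' U n₀ ≤ hi₀) (hlo₁ : lo₁ ≤ energyDensityTT' t t' U n₁)
    (hlo₂ : lo₂ ≤ energyDensityTT' t t' U n₂) (hhi₃ : energyDensityTT' t t' U n₃ ≤ hi₃)
    {m n : ℝ} (hm : m ∈ Icc n₁ n₂) (hn : n ∈ Icc n₁ n₂) :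
    |energyDensityTT' t t' U n - energyDensityTT' t t' U m| ≤
      max |(lo₁ - hi₀) / (n₁ - n₀)| |(hi₃ - lo₂) / (n₃ - n₂)| * |n - m| := by
  set μlo := (lo₁ - hi₀) / (n₁ - n₀)
  set μhi := (hi₃ - lo₂) / (n₃ - n₂)
  -- reduce to `m ≤ n` by symmetry
  wlog hmn : m ≤ n generalizing m n
  · have h := this hn hm (le_of_not_ge hmn)
    rwa [abs_sub_comm, abs_sub_comm n m]
  obtain ⟨h1, h2⟩ := energyDensityTT'_sub_mem_Icc_of_bounds t t' hU hn₀ h₀₁ h₁₂ h₂₃ hn₃ hhi₀ hlo₁ hlo₂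
    hhi₃ hm hn hmn
  have hd : 0 ≤ n - m := sub_nonneg.2 hmn
  rw [abs_of_nonneg hd, abs_le]
  constructor
  · -- `-(M (n-m)) ≤ -|μlo|(n-m) ≤ μlo (n-m) ≤ e(n) - e(m)`
    have a1 : -(max |μlo| |μhi| * (n - m)) ≤ -(|μlo| * (n - m)) :=
      neg_le_neg (mul_le_mul_of_nonneg_right (le_max_left _ _) hd)
    have a2 : -(|μlo| * (n - m)) ≤ μlo * (n - m) := by
      rw [← neg_mul]; exact mul_le_mul_of_nonneg_right (neg_abs_le _) hd
    exact a1.trans (a2.trans h1)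
  · have b1 : μhi * (n - m) ≤ |μhi| * (n - m) := mul_le_mul_of_nonneg_right (le_abs_self _) hd
    have b2 : |μhi| * (n - m) ≤ max |μlo| |μhi| * (n - m) :=
      mul_le_mul_of_nonneg_right (le_max_right _ _) hd
    exact h2.trans (b1.trans b2)

end ThermodynamicLimit

end Literature.MathematicalPhysics.QuantumLattice

end
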